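import Summits.BirchSwinnertonDyer.BirchSwinnertonDyer.Theorems.Rank1ResidualJetUnramifiedEigenCount
import HarnessLib

/-!
# Crux V2♭θ `KolyvaginCorankLowerBoundAtTwoTheta` (stmt-BirchSwinnertonDyer-27220), line
# `kolyvagin_depth_split`, inside of S1, piece P7a — brick E with the MAP: for a trivial finite
# Galois module `W` of a local field, evaluation at a Frobenius is an ADDITIVE EQUIVALENCE
# `H¹_ur(F, W) ≃+ W` intertwining a compatible-pair endomorphism `T` of `H¹` with `t` on `W`
# (helper, PROVED, generic; width seat `bsd-line-krr2-p2` g6)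

Road-K JET's brick E (`natCard_unramifiedSubgroup_inf_ker_eq_natCard_ker`) exports only the COUNT
`#(H¹_ur ∩ ker(T − s)) = #ker(t − s)`.  At the prime `2` the eigen-line argument of the prime swap
needs ORDERS of eigen-classes (an `s`-eigen-class of order `2^M` in `Kum_v`), i.e. the evaluation
map itself.  This file re-runs brick E's argument and exports
* `exists_addEquiv_unramified_eval` — an additive equivalence `e : H¹_ur(F, W) ≃+ W` (evaluation
  of the representing homomorphism at the Frobenius `φ`) such that `T` preserves `H¹_ur` and
  `e (T c) = t (e c)`;
* `exists_mem_unramified_eigen_zsmul_ne_zero` — consequently an `s`-eigenvector `w` of `t` with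
  `n • w ≠ 0` yields a class `c ∈ H¹_ur ∩ ker(T − s)` with `n • c ≠ 0`.
HONEST FRAMING: helper lemmas (`--supports` 27220); S1 / V2♭θ are NOT proved; BSD is not proved.

References: [Jetchev2008] §3.2 (2) (p. 815); [Rubin2011] Prop. 1.4.13 (1); [MilneADT2006] Ch. I
Lemma 2.9; [SerreLocalFields1979] Ch. XIII §1.
-/

set_option autoImplicit false
-- the Theorems namespace of this sub repeats the summit name by design (D-0017 nested layout)
set_option linter.dupNamespace false

noncomputable section

open scoped Classical
open Function Field
open Literature.NumberTheory.GaloisRepresentations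
open Literature.NumberTheory.GaloisRepresentations.IsNonarchimedeanLocalField
open _root_.TopRep _root_.ContinuousCohomology
open Summit.BirchSwinnertonDyer.Rank1Residual
open Summit.BirchSwinnertonDyer.Rank1Residual.JET.GlobalDuality

universe u

namespace Summit.BirchSwinnertonDyer.BirchSwinnertonDyer.Theorems.KolyvaginLowerBoundAtTwo

section TrivialLocal

variable {F : Type u} [Field F] [ValuativeRel F] [TopologicalSpace F] [IsNonarchimedeanLocalField F]
variable {W : Type u} [AddCommGroup W] [TopologicalSpace W] [DiscreteTopology W]
  (ρ : DiscreteGaloisModule F W)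

variable [Finite W]

/-- **Evaluation at a Frobenius is an additive equivalence `H¹_ur(F, W) ≃+ W` (trivial action)
intertwining `T` with `t`.** For `T : H¹ → H¹` given on cocycles by `[ψ] ↦ [g ↦ t(ψ(f g))]`
(`f` carrying a Frobenius to a Frobenius and inertia into inertia): `T` preserves `H¹_ur(F, W)` and
there is `e : H¹_ur(F, W) ≃+ W` with `e (T c) = t (e c)`. Jetchev 2008 §3.2 (2):
`H¹_f(K_λ, E[p^k]) ≅ E[p^k]` with `τ` acting through `E[p^k]`. [cite: Jetchev2008, §3.2 (2) (p. 815)]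
[cite: Rubin2011, Prop. 1.4.13 (1) (p. 9)] -/
theorem exists_addEquiv_unramified_eval
    (htriv : ∀ (g : absoluteGaloisGroup F) (w : W), ρ g w = w)
    {φ : absoluteGaloisGroup F} (hφ : IsFrobPow φ 1)
    (T : galoisCohomology ρ 1 →+ galoisCohomology ρ 1) (t : W →+ W)
    (f : absoluteGaloisGroup F → absoluteGaloisGroup F)
    (hT : ∀ ψ : contOneCocycles ρ.toTopRep, ∃ ψ' : contOneCocycles ρ.toTopRep,
      T (oneCocycleClass ρ.toTopRep ψ) = oneCocycleClass ρ.toTopRep ψ' ∧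
        ∀ g, ψ'.1 g = t (ψ.1 (f g)))
    (hf : IsFrobPow (f φ) 1) (hfI : ∀ τ ∈ absInertia F, f τ ∈ absInertia F) :
    ∃ e : ↥(DiscreteGaloisModule.unramifiedSubgroup ρ 1) ≃+ W,
      (∀ c : galoisCohomology ρ 1, c ∈ DiscreteGaloisModule.unramifiedSubgroup ρ 1 →
        T c ∈ DiscreteGaloisModule.unramifiedSubgroup ρ 1) ∧
      ∀ (c : ↥(DiscreteGaloisModule.unramifiedSubgroup ρ 1))
        (hTc : T c.1 ∈ DiscreteGaloisModule.unramifiedSubgroup ρ 1), e ⟨T c.1, hTc⟩ = t (e c) := by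
  have hinj : Injective (oneCocycleClass ρ.toTopRep) := oneCocycleClass_injective_of_trivial ρ.toTopRep htriv
  have hI : ∀ τ ∈ absInertia F, ∀ w : W, ρ τ w = w := fun τ _ w => htriv τ w
  -- the representing cocycle of a class (unique: trivial action)
  have hrep : ∀ c : galoisCohomology ρ 1, ∃ ψ : contOneCocycles ρ.toTopRep,
      oneCocycleClass ρ.toTopRep ψ = c := fun c => oneCocycleClass_surjective ρ.toTopRep c
  choose rep hrep using hrep
  have hrep_class : ∀ ψ : contOneCocycles ρ.toTopRep, rep (oneCocycleClass ρ.toTopRep ψ) = ψ :=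
    fun ψ => hinj (hrep _)
  have hur : ∀ c : galoisCohomology ρ 1, c ∈ DiscreteGaloisModule.unramifiedSubgroup ρ 1 ↔
      ∀ τ ∈ absInertia F, (rep c).1 τ = 0 := fun c => by
    conv_lhs => rw [← hrep c]
    exact X11b.LocBridge.mem_unramifiedSubgroup_one_iff_forall_eq_zero ρ hI (rep c)
  -- cocycle arithmetic
  have hadd : ∀ (ψ₁ ψ₂ : contOneCocycles ρ.toTopRep) (g), (ψ₁ + ψ₂).1 g = ψ₁.1 g + ψ₂.1 g :=
    fun ψ₁ ψ₂ g => by rw [Submodule.coe_add, ContinuousMap.add_apply]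
  have hsub : ∀ (ψ₁ ψ₂ : contOneCocycles ρ.toTopRep) (g), (ψ₁ - ψ₂).1 g = ψ₁.1 g - ψ₂.1 g :=
    fun ψ₁ ψ₂ g => by rw [Submodule.coe_sub, ContinuousMap.sub_apply]
  have hclass_add : ∀ ψ₁ ψ₂ : contOneCocycles ρ.toTopRep,
      (oneCocycleClass ρ.toTopRep (ψ₁ + ψ₂) : galoisCohomology ρ 1) =
        oneCocycleClass ρ.toTopRep ψ₁ + oneCocycleClass ρ.toTopRep ψ₂ :=
    fun ψ₁ ψ₂ => map_add (oneCocycleClassₗ ρ.toTopRep) ψ₁ ψ₂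
  have hrep_add : ∀ c₁ c₂ : galoisCohomology ρ 1, rep (c₁ + c₂) = rep c₁ + rep c₂ := fun c₁ c₂ => by
    apply hinj
    rw [hclass_add, hrep, hrep, hrep]
    rfl
  -- `T` preserves `H¹_ur`, and the value of a representative of `T c` at `φ`
  have hTdata : ∀ c : galoisCohomology ρ 1, c ∈ DiscreteGaloisModule.unramifiedSubgroup ρ 1 →
      T c ∈ DiscreteGaloisModule.unramifiedSubgroup ρ 1 ∧ (rep (T c)).1 φ = t ((rep c).1 φ) := by
    intro c hc
    obtain ⟨ψ', hTψ, hψ'⟩ := hT (rep c)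
    rw [hrep] at hTψ
    have hcur : ∀ τ ∈ absInertia F, (rep c).1 τ = 0 := (hur c).mp hc
    have hψ'I : ∀ τ ∈ absInertia F, ψ'.1 τ = 0 := fun τ hτ => by
      rw [hψ', hcur _ (hfI τ hτ), map_zero]
    have hrepT : rep (T c) = ψ' := by rw [hTψ, hrep_class]
    refine ⟨(hur (T c)).mpr (by rw [hrepT]; exact hψ'I), ?_⟩
    rw [hrepT, hψ', apply_eq_apply_of_isFrobPow ρ htriv hφ hf (rep c) hcur]
  -- ### evaluation at `φ` as an additive map on `H¹_ur`
  set U := DiscreteGaloisModule.unramifiedSubgroup ρ 1 with hU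
  let ev : ↥U →+ W := AddMonoidHom.mk' (fun c => (rep c.1).1 φ) (fun a b => by
    change (rep (a.1 + b.1)).1 φ = (rep a.1).1 φ + (rep b.1).1 φ
    rw [hrep_add, hadd])
  have hev : ∀ c : ↥U, ev c = (rep c.1).1 φ := fun _ => rfl
  -- injective
  have hev_inj : Injective ev := by
    intro c₁ c₂ h
    rw [hev, hev] at h
    have hz : ∀ g, (rep c₁.1 - rep c₂.1).1 g = 0 :=
      apply_eq_zero_of_unramified_of_apply_frob_eq_zero ρ htriv hφ (rep c₁.1 - rep c₂.1)
        (fun τ hτ => by rw [hsub, (hur c₁.1).mp c₁.2 τ hτ, (hur c₂.1).mp c₂.2 τ hτ, sub_zero])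
        (by rw [hsub, h, sub_self])
    have heq : rep c₁.1 = rep c₂.1 := by
      apply Subtype.ext; ext g
      exact sub_eq_zero.mp ((hsub _ _ g).symm.trans (hz g))
    exact Subtype.ext (by rw [← hrep c₁.1, ← hrep c₂.1, heq])
  -- and bijective (`#H¹_ur = #W`)
  have hcard : Nat.card ↥U = Nat.card W := by
    rw [hU, GaloisImage.natCard_unramifiedSubgroup_eq_natCard_invariants ρ hI]
    exact Nat.card_congr
      { toFun := fun x => x.1
        invFun := fun w => ⟨w, fun g => htriv g w⟩
        left_inv := fun _ => rfl
        right_inv := fun _ => rfl }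
  haveI : Finite ↥U := Nat.finite_of_card_ne_zero (by rw [hcard]; exact Nat.card_pos.ne')
  have hev_bij : Bijective ev := by
    rw [Nat.bijective_iff_injective_and_card]
    exact ⟨hev_inj, hcard⟩
  refine ⟨AddEquiv.ofBijective ev hev_bij, fun c hc => (hTdata c hc).1, fun c hTc => ?_⟩
  rw [AddEquiv.ofBijective_apply, AddEquiv.ofBijective_apply, hev, hev]
  exact (hTdata c.1 c.2).2

/-- **An `s`-eigenvector of `t` of large order gives an `s`-eigen-class in `H¹_ur ∩ ker(T − s)` of
large order** (trivial action; `T`, `t`, `f` a compatible pair as in brick E): if `t w = s • w`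
and `n • w ≠ 0` then some `c ∈ H¹_ur(F, W) ∩ ker(T − s)` has `n • c ≠ 0`. At a Kolyvagin prime at
`2` this moves an eigenvector of order `2^M` of complex conjugation on `E[2^M]` to the local
Kummer group. [cite: Jetchev2008, §3.2 (2) (p. 815)] -/
theorem exists_mem_unramified_eigen_zsmul_ne_zero
    (htriv : ∀ (g : absoluteGaloisGroup F) (w : W), ρ g w = w)
    {φ : absoluteGaloisGroup F} (hφ : IsFrobPow φ 1)
    (T : galoisCohomology ρ 1 →+ galoisCohomology ρ 1) (t : W →+ W)
    (f : absoluteGaloisGroup F → absoluteGaloisGroup F)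
    (hT : ∀ ψ : contOneCocycles ρ.toTopRep, ∃ ψ' : contOneCocycles ρ.toTopRep,
      T (oneCocycleClass ρ.toTopRep ψ) = oneCocycleClass ρ.toTopRep ψ' ∧
        ∀ g, ψ'.1 g = t (ψ.1 (f g)))
    (hf : IsFrobPow (f φ) 1) (hfI : ∀ τ ∈ absInertia F, f τ ∈ absInertia F) (s : ℤ)
    {w : W} (hw : t w = s • w) {n : ℤ} (hn : n • w ≠ 0) :
    ∃ c : galoisCohomology ρ 1,
      c ∈ DiscreteGaloisModule.unramifiedSubgroup ρ 1 ⊓ (T - s • AddMonoidHom.id _).ker ∧ n • c ≠ 0 := by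
  obtain ⟨e, hTU, he⟩ := exists_addEquiv_unramified_eval ρ htriv hφ T t f hT hf hfI
  set c := e.symm w with hc
  have hec : e c = w := by rw [hc, e.apply_symm_apply]
  have hTc : T c.1 ∈ DiscreteGaloisModule.unramifiedSubgroup ρ 1 := hTU c.1 c.2
  refine ⟨c.1, AddSubgroup.mem_inf.mpr ⟨c.2, ?_⟩, fun h0 => hn ?_⟩
  · rw [AddMonoidHom.mem_ker, AddMonoidHom.sub_apply, AddMonoidHom.smul_apply, AddMonoidHom.id_apply,
      sub_eq_zero]
    have h1 : e ⟨T c.1, hTc⟩ = e (s • c) := by rw [he c hTc, hec, map_zsmul, hec, hw]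
    have h2 := e.injective h1
    have h3 := congrArg Subtype.val h2
    rw [AddSubgroupClass.coe_zsmul] at h3
    exact h3
  · have h1 : n • c = 0 := Subtype.ext (by
      rw [AddSubgroupClass.coe_zsmul, ZeroMemClass.coe_zero]; exact h0)
    rw [← hec, ← map_zsmul, h1, map_zero]

end TrivialLocal

end Summit.BirchSwinnertonDyer.BirchSwinnertonDyer.Theorems.KolyvaginLowerBoundAtTwo

end
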